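import Summits.HubbardSuperconductivity.HubbardSuperconductivity.Theorems.AnisotropyChordTransferFibre3Hole2Quarter

/-!
# Route `AnisotropyChord` / H0 rotor rung: HOLE₂(.75) at `L = 30` — kernel facts, part d (33 of the 135 `D₄`-classes)

KERNEL FACT for the twice-punctured `30 × 30` torus (zero data): the quarter-table interval Birman–Schwinger checker `Hole2.checkRepsQ`
(`…Fibre3Hole2Quarter`) accepts the listed separations at the certified constant `g_30 ≥ ¾ε₁(30)`, by ONE `decide +kernel`
(`maxHeartbeats 400000` pre-budgeted: the quarter Green table alone is ¾L³ interval operations, recomputed in each part).  The parts are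
glued in `…Hole2L30` (`checkRepsQ_append`) and turned into `TwoHoleGap 30 (3/4·eps1 30)` by `Hole2.twoHoleGap_of_checkRepsQ`.
Prover seat `hubbard-h0-rotor-p3` g3; helper for stmt-HubbardSuperconductivity-19089 (`--supports`, helper class).
WHAT THIS IS NOT: nothing here proves superconductivity in the Hubbard model (rotor TARGET as worded stays FALSE, g15 verdict);
kernel facts for ONE input (HOLE₂(.75) at one `L`) of ONE conditional reduction (rung 19089). Tree imports only; no sorry, no `native_decide`.
-/

set_option linter.dupNamespace false
set_option autoImplicit false

namespace Summit.HubbardSuperconductivity.HubbardSuperconductivity.Theorems.AnisotropyChord.Transfer.Fibre3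

namespace Hole2

/-- `D₄`-representatives of the nonzero separations of the `30 × 30` torus, part d. [folklore] -/
def reps30d : List (ℕ × ℕ) := [(13, 12), (13, 13), (14, 0), (14, 1), (14, 2), (14, 3), (14, 4), (14, 5), (14, 6), (14, 7), (14, 8), (14, 9), (14, 10), (14, 11), (14, 12), (14, 13), (14, 14), (15, 0), (15, 1), (15, 2), (15, 3), (15, 4), (15, 5), (15, 6), (15, 7), (15, 8), (15, 9), (15, 10), (15, 11), (15, 12), (15, 13), (15, 14), (15, 15)]

set_option maxHeartbeats 400000 in
/-- kernel fact: part d passes the quarter-table interval Birman–Schwinger test at `g_30 ≥ ¾ε₁(30)`. [folklore] -/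
theorem checkRepsQ_30d : checkRepsQ 30 reps30d = true := by
  decide +kernel

end Hole2

end Summit.HubbardSuperconductivity.HubbardSuperconductivity.Theorems.AnisotropyChord.Transfer.Fibre3
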